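import Mathlib
import Summits.Ventures.LatticeQCDFlow.TrivializingMaps.SlotLipschitz
import Summits.Ventures.LatticeQCDFlow.TrivializingMaps.GradedSupBounds
import Summits.Ventures.LatticeQCDFlow.TrivializingMaps.GeneratorLocality
import Summits.Ventures.LatticeQCDFlow.TrivializingMaps.WilsonFlowActionSeries
import HarnessLib

/-!
# The truncated Wilson-flow generator is Lipschitz in the links, uniformly in the volume (`K_Z`)

HONEST FRAMING. This venture is about exact (Metropolis-corrected) sampling algorithms for lattice
gauge theory; figures of merit are autocorrelation/cost numbers at stated couplings and volumes; no
continuum-physics claim. This file is pure finite-dimensional analysis on `SU(n)^E`.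

WHAT IS PROVED (theory-1 row 80, the input `K_Z` of THEOREM L = `FlowLightCone.lean`). For Lüscher's
graded flow-action series `S̃^{(k)}` of the Wilson action ([Luscher2010Trivializing] §4, eqs.
(4.7)–(4.9); tree `GradedSeries.gradedSk`) and every order `N`, the truncated generator
`Z_t(U)(e) = ∂S̃^{[N]}_{β,t}(U)(e) = ∑ₐ (∂^a_e ∑_{k≤N} t^k β^{k+1} S̃^{(k)})(U) T^a` satisfies, for any two
lattice gauge fields `U, U' ∈ SU(n)^E` on the periodic lattice `(ℤ/L)^d` and every link `e`,

  `‖Z_t(U)(e) − Z_t(U')(e)‖_F ≤ K(t) · max_{e' ∈ linkBall (2(N+1)) e} ‖U_{e'} − U'_{e'}‖_F`,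
  `K(t) = (∑_{k≤N} |t|^k |β|^{k+1} · 4(k+1) · n² · N₀ θ₁^k) · ∑ₐ ‖T^a‖_F`

(`abs_linkDeriv_truncFlowAction_smul_gradedSk_sub_le_of_linkBall`,
`norm_linkGrad_truncFlowAction_smul_gradedSk_sub_le_of_linkBall`), with the constants `N₀ = N₀(d,n)`,
`θ₁ = θ₁(d,n,B)` of the graded THEOREM A (`GradedTheoremA.lean`) — in particular with NO dependence on
the volume `L`. Together with `M_Z` (`TruncatedGeneratorSupBound.lean`) this discharges both hypotheses
of `IsFlowMap.lightCone` for the order-`N` truncated Wilson-flow maps.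

THE ONE IDEA (no mean-value theorem, no geodesics, no matrix logarithm). Every graded term is a matrix
coefficient `Re(z ⟪y, R_σ(U) x⟫)` of the slot representation `R_σ(U) = ⊗_s u_s`, a Kronecker product
of the unitaries `u_s = U(lnk s)^{(±)}`. Exchanging the factors one slot at a time,
`⊗_s u'_s − ⊗_s u_s = ∑_s ins_s(u'_s − u_s) · (⊗ of unitaries)` (hybrid telescoping), and an
insertion `ins_s(X) = 1 ⊗ … ⊗ X ⊗ … ⊗ 1` has operator norm `≤ ∑_{ij} |X_{ij}| ≤ n ‖X‖_F` (each
`ins_s(E_{ij} c)` is `|c|` times a partial isometry). Hence the LIPSCHITZ IDENTITY between any two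
points of the field manifold (`SlotLipschitz.lean`, row 80a)

  `|Re(z⟪y, R_σ(U)x⟫) − Re(z⟪y, R_σ(U')x⟫)| ≤ |z| ‖x‖ ‖y‖ · ∑_s ∑_{ij} |(U − U')(lnk s)_{ij}|`.

Since `∂^a_e Re(z⟪y,R x⟫) = −Re(z⟪T^{σ,e}_a y, R x⟫)` (`RankOne.linkDeriv_termF_skew`) with
`‖T^{σ,e}_a y‖ ≤ √m_e ‖y‖` on the joint-Casimir block (`SlotHilbert.norm_genCLM_jointProj_le`), the
same identity bounds DIFFERENCES OF LINK DERIVATIVES, and the graded THEOREM A bookkeeping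
(`GradedMasses`, `GradedTheoremA.mass_pack_le`) goes through verbatim with one extra factor
`|σ_k| · n = 4(k+1) n` (§3–§4 below). Localisation to the plaquette ball (§6) is the tree's
`GeneratorLocality.linkDeriv_series_local` applied to a hybrid configuration.

All constants are explicit; nothing here is sharp (the factor `4(k+1)n` could be improved to the
number of slots actually carrying a link of the ball, and `∑_{ij}|X_{ij}| ≤ n‖X‖_F` to `√n`-type
bounds), and sharpness is irrelevant for the volume-uniformity statement.

Sources: [Luscher2010Trivializing] M. Lüscher, Commun. Math. Phys. 293 (2010) 899, arXiv:0907.5491,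
§4; hybrid/telescoping estimates for tensor products are folklore (Lieb–Robinson-bound literature,
e.g. arXiv:0902.0025 §2). Everything below is [ours] unless marked [folklore].
-/

open scoped Matrix ComplexConjugate InnerProductSpace Matrix.Norms.Frobenius
open Finset

/-! ## 3. Generations: the mass bookkeeping for differences -/

namespace Summit.Ventures.LatticeQCDFlow.TrivializingMaps.GradedSeries

open Literature.MathematicalPhysics.QuantumFieldTheory
open Literature.MathematicalPhysics.QuantumFieldTheory.Luscher2010
open SlotRepresentation SlotCasimir SlotHilbert JointGrading CasimirGrading RankOne

variable {d L n : ℕ} [NeZero L]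

namespace Gen
variable {B : SuBasis n} {σ : Type} [Fintype σ] [DecidableEq σ] (G : Gen (d := d) (L := L) B σ)

omit [NeZero L] in
/-- Lipschitz bound for one datum of a generation:
`|∂^a_e termᵢ(ιU) − ∂^a_e termᵢ(ιU')| ≤ wtᵢ(e) νᵢ ∑_s ∑_{pq} |(U − U')(lnkᵢ s)_{pq}|`. [ours] -/
theorem abs_linkDeriv_term_sub_le (i : G.I) (e : Edge d L) (a : B.ι)
    (U U' : GaugeConfig d L (Matrix.specialUnitaryGroup (Fin n) ℂ)) :
    |linkDeriv e (B.T a) (G.term i) (WilsonFlow.coeConfig U)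
        - linkDeriv e (B.T a) (G.term i) (WilsonFlow.coeConfig U')|
      ≤ G.wt i e * G.nu i *
          ∑ s, ∑ p, ∑ q, ‖(WilsonFlow.coeConfig U (G.lnk i s) - WilsonFlow.coeConfig U' (G.lnk i s)) p q‖ := by
  have h := abs_linkDeriv_termF_sub_le (G.lnk i) (G.pol i) (G.z i) (G.x i) B (G.m i) (G.v i) e a
    (coeConfig_mem_unitaryGroup U) (coeConfig_mem_unitaryGroup U')
  refine (le_of_eq rfl).trans (h.trans (le_of_eq ?_))
  unfold wt nu Gen.y
  ring

/-- With dead data carrying no coefficient, `∑ᵢ wtᵢ(e) νᵢ = N_G(e)`. [ours] -/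
theorem sum_wt_mul_nu_eq_mass (hz : ∀ i, G.cm i = 0 → G.z i = 0) (e : Edge d L) :
    ∑ i, G.wt i e * G.nu i = G.mass e := by
  unfold mass live
  rw [Finset.sum_filter_of_ne]
  intro i _ hi hc
  apply hi
  have : G.nu i = 0 := by unfold nu; rw [hz i hc, norm_zero, zero_mul]
  rw [this, mul_zero]

/-- **Domination of differences**: if dead data carry no coefficient and all link differences have
entrywise `ℓ¹` norm `≤ M`, then `|∂^a_e G.func(ιU) − ∂^a_e G.func(ιU')| ≤ |σ| M N_G(e)`. [ours] -/
theorem abs_linkDeriv_func_sub_le (hz : ∀ i, G.cm i = 0 → G.z i = 0) (e : Edge d L) (a : B.ι)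
    (U U' : GaugeConfig d L (Matrix.specialUnitaryGroup (Fin n) ℂ)) {M : ℝ}
    (hM : ∀ e', ∑ p, ∑ q, ‖(WilsonFlow.coeConfig U e' - WilsonFlow.coeConfig U' e') p q‖ ≤ M) :
    |linkDeriv e (B.T a) G.func (WilsonFlow.coeConfig U) - linkDeriv e (B.T a) G.func (WilsonFlow.coeConfig U')|
      ≤ Fintype.card σ * M * G.mass e := by
  rw [G.linkDeriv_func, G.linkDeriv_func, ← Finset.sum_sub_distrib]
  refine (Finset.abs_sum_le_sum_abs _ _).trans ?_
  have h1 : ∀ i, |linkDeriv e (B.T a) (G.term i) (WilsonFlow.coeConfig U)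
        - linkDeriv e (B.T a) (G.term i) (WilsonFlow.coeConfig U')|
      ≤ G.wt i e * G.nu i * (Fintype.card σ * M) := by
    intro i
    refine (G.abs_linkDeriv_term_sub_le i e a U U').trans ?_
    refine mul_le_mul_of_nonneg_left ?_ (mul_nonneg (G.wt_nonneg i e) (G.nu_nonneg i))
    calc ∑ s, ∑ p, ∑ q, ‖(WilsonFlow.coeConfig U (G.lnk i s) - WilsonFlow.coeConfig U' (G.lnk i s)) p q‖
        ≤ ∑ _s : σ, M := Finset.sum_le_sum fun s _ => hM _
      _ = Fintype.card σ * M := by rw [Finset.sum_const, Finset.card_univ, nsmul_eq_mul]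
  refine (Finset.sum_le_sum fun i _ => h1 i).trans (le_of_eq ?_)
  rw [← Finset.sum_mul, G.sum_wt_mul_nu_eq_mass hz e]
  ring

end Gen

/-! ## 4. The graded series: `|∂^a_e S̃^{(k)}(ιU) − ∂^a_e S̃^{(k)}(ιU')| ≤ 4(k+1) n N₀ θ₁^k · max‖U − U'‖_F` -/

variable (B : SuBasis n)

/-- Generation `k` lives on `4(k+1)` slots. [ours] -/
theorem card_pack_σ (k : ℕ) : Fintype.card (pack (d := d) (L := L) B k).σ = 4 * (k + 1) := by
  induction k with
  | zero => rfl
  | succ k ih =>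
    rw [Fintype.card_congr' (show (pack (d := d) (L := L) B (k + 1)).σ = (Fin 4 ⊕ (pack (d := d) (L := L) B k).σ)
      from rfl), Fintype.card_sum, Fintype.card_fin, ih]
    ring

/-- **Volume-uniform Lipschitz bound for the graded series** (entrywise form): if every link difference
has entrywise `ℓ¹` norm `≤ M`, then
`|∂^a_e S̃^{(k)}(ιU) − ∂^a_e S̃^{(k)}(ιU')| ≤ 4(k+1) · M · N₀ θ₁^k`. [ours] -/
theorem abs_linkDeriv_gradedSk_sub_le_of_sum (hn : n ≠ 0) (k : ℕ) (e : Edge d L) (a : B.ι)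
    (U U' : GaugeConfig d L (Matrix.specialUnitaryGroup (Fin n) ℂ)) {M : ℝ} (hM0 : 0 ≤ M)
    (hM : ∀ e', ∑ p, ∑ q, ‖(WilsonFlow.coeConfig U e' - WilsonFlow.coeConfig U' e') p q‖ ≤ M) :
    |linkDeriv e (B.T a) (gradedSk (d := d) (L := L) B k) (WilsonFlow.coeConfig U)
        - linkDeriv e (B.T a) (gradedSk (d := d) (L := L) B k) (WilsonFlow.coeConfig U')|
      ≤ 4 * ((k : ℝ) + 1) * M * (N0 d n * theta1 d n B ^ k) := by
  have h := (pack (d := d) (L := L) B k).G.abs_linkDeriv_func_sub_le (pack_z_eq_zero B k) e a U U' hM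
  rw [card_pack_σ] at h
  refine h.trans ?_
  push_cast
  have hm := mass_pack_le (d := d) (L := L) B hn k e
  have h4 : 0 ≤ 4 * ((k : ℝ) + 1) * M := by positivity
  calc (4 * ((k : ℝ) + 1)) * M * (pack (d := d) (L := L) B k).G.mass e
      ≤ 4 * ((k : ℝ) + 1) * M * (N0 d n * theta1 d n B ^ k) := mul_le_mul_of_nonneg_left hm h4

/-- **Volume-uniform Lipschitz bound for the graded series** (Frobenius form): if
`‖U_{e'} − U'_{e'}‖_F ≤ M` for every link, then
`|∂^a_e S̃^{(k)}(ιU) − ∂^a_e S̃^{(k)}(ιU')| ≤ 4(k+1) n · N₀ θ₁^k · M`, independently of `L`. [ours] -/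
theorem abs_linkDeriv_gradedSk_sub_le (hn : n ≠ 0) (k : ℕ) (e : Edge d L) (a : B.ι)
    (U U' : GaugeConfig d L (Matrix.specialUnitaryGroup (Fin n) ℂ)) {M : ℝ} (hM0 : 0 ≤ M)
    (hM : ∀ e', ‖WilsonFlow.coeConfig U e' - WilsonFlow.coeConfig U' e'‖ ≤ M) :
    |linkDeriv e (B.T a) (gradedSk (d := d) (L := L) B k) (WilsonFlow.coeConfig U)
        - linkDeriv e (B.T a) (gradedSk (d := d) (L := L) B k) (WilsonFlow.coeConfig U')|
      ≤ 4 * ((k : ℝ) + 1) * n * (N0 d n * theta1 d n B ^ k) * M := by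
  have hM' : ∀ e', ∑ p, ∑ q, ‖(WilsonFlow.coeConfig U e' - WilsonFlow.coeConfig U' e') p q‖ ≤ n * M :=
    fun e' => (sum_norm_apply_le_mul_norm _).trans (mul_le_mul_of_nonneg_left (hM e') (Nat.cast_nonneg n))
  refine (abs_linkDeriv_gradedSk_sub_le_of_sum B hn k e a U U' (by positivity) hM').trans (le_of_eq ?_)
  ring

end Summit.Ventures.LatticeQCDFlow.TrivializingMaps.GradedSeries

/-! ## 5. The truncated β-scaled generator: global Lipschitz bound -/

namespace Summit.Ventures.LatticeQCDFlow.TrivializingMaps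

open Literature.MathematicalPhysics.QuantumFieldTheory
open Literature.MathematicalPhysics.QuantumFieldTheory.Luscher2010

variable {d L n : ℕ} [NeZero L]

omit [NeZero L] in
/-- `‖∂f(W)(e) − ∂f(W')(e)‖_F ≤ K ∑ₐ ‖T^a‖_F` if every colour component differs by `≤ K`. [folklore] -/
theorem norm_linkGrad_sub_linkGrad_le (B : SuBasis n) (f : AmbConfig d L n → ℝ) (W W' : AmbConfig d L n)
    (e : Edge d L) {K : ℝ} (h : ∀ a, |linkDeriv e (B.T a) f W - linkDeriv e (B.T a) f W'| ≤ K) :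
    ‖linkGrad B f W e - linkGrad B f W' e‖ ≤ K * ∑ a, ‖B.T a‖ := by
  unfold linkGrad
  rw [← Finset.sum_sub_distrib]
  refine (norm_sum_le _ _).trans ?_
  rw [Finset.mul_sum]
  refine Finset.sum_le_sum fun a _ => ?_
  rw [← sub_smul, norm_smul, ← Complex.ofReal_sub, Complex.norm_real, Real.norm_eq_abs]
  exact mul_le_mul_of_nonneg_right (h a) (norm_nonneg _)

namespace GradedSeries

variable (B : SuBasis n)

/-- **Colour gradients of the truncated generator are Lipschitz, every volume** (global form): if
`‖U_{e'} − U'_{e'}‖_F ≤ M` for every link `e'`, then for every link `e` and colour `a`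
`|∂^a_e S̃^{[N]}_{β,t}(ιU) − ∂^a_e S̃^{[N]}_{β,t}(ιU')| ≤ (∑_{k≤N} |t|^k |β|^{k+1} 4(k+1) n N₀ θ₁^k) M`.
[ours] -/
theorem abs_linkDeriv_truncFlowAction_smul_gradedSk_sub_le (hn : n ≠ 0) (β t : ℝ) (N : ℕ)
    (e : Edge d L) (a : B.ι) (U U' : GaugeConfig d L (Matrix.specialUnitaryGroup (Fin n) ℂ)) {M : ℝ}
    (hM0 : 0 ≤ M) (hM : ∀ e', ‖WilsonFlow.coeConfig U e' - WilsonFlow.coeConfig U' e'‖ ≤ M) :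
    |linkDeriv e (B.T a)
        (truncFlowAction (fun k W => β ^ (k + 1) * gradedSk (d := d) (L := L) B k W) t N)
        (WilsonFlow.coeConfig U)
      - linkDeriv e (B.T a)
        (truncFlowAction (fun k W => β ^ (k + 1) * gradedSk (d := d) (L := L) B k W) t N)
        (WilsonFlow.coeConfig U')|
      ≤ (∑ k ∈ Finset.range (N + 1), |t| ^ k * (|β| ^ (k + 1) *
          (4 * ((k : ℝ) + 1) * n * (N0 d n * theta1 d n B ^ k)))) * M := by
  rw [linkDeriv_truncFlowAction (contDiff_smul_gradedSk B β),
    linkDeriv_truncFlowAction (contDiff_smul_gradedSk B β), ← Finset.sum_sub_distrib, Finset.sum_mul]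
  refine (Finset.abs_sum_le_sum_abs _ _).trans (Finset.sum_le_sum fun k _ => ?_)
  rw [← mul_sub, linkDeriv_const_mul' e (B.T a) (β ^ (k + 1)) _ (WilsonFlow.coeConfig U),
    linkDeriv_const_mul' e (B.T a) (β ^ (k + 1)) _ (WilsonFlow.coeConfig U'), ← mul_sub, abs_mul,
    abs_mul, abs_pow, abs_pow, mul_assoc, mul_assoc]
  refine mul_le_mul_of_nonneg_left ?_ (pow_nonneg (abs_nonneg t) _)
  exact mul_le_mul_of_nonneg_left (abs_linkDeriv_gradedSk_sub_le B hn k e a U U' hM0 hM)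
    (pow_nonneg (abs_nonneg β) _)

/-- **`K_Z` — the truncated generator is Lipschitz on the field manifold, every volume** (global
form): `‖∂S̃^{[N]}_{β,t}(ιU)(e) − ∂S̃^{[N]}_{β,t}(ιU')(e)‖_F ≤ K(t) · max_{e'} ‖U_{e'} − U'_{e'}‖_F` with
`K(t) = (∑_{k≤N} |t|^k |β|^{k+1} 4(k+1) n N₀ θ₁^k) ∑ₐ ‖T^a‖_F`. [ours] -/
theorem norm_linkGrad_truncFlowAction_smul_gradedSk_sub_le (hn : n ≠ 0) (β t : ℝ) (N : ℕ)
    (e : Edge d L) (U U' : GaugeConfig d L (Matrix.specialUnitaryGroup (Fin n) ℂ)) {M : ℝ}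
    (hM0 : 0 ≤ M) (hM : ∀ e', ‖WilsonFlow.coeConfig U e' - WilsonFlow.coeConfig U' e'‖ ≤ M) :
    ‖linkGrad B (truncFlowAction (fun k W => β ^ (k + 1) * gradedSk (d := d) (L := L) B k W) t N)
          (WilsonFlow.coeConfig U) e
      - linkGrad B (truncFlowAction (fun k W => β ^ (k + 1) * gradedSk (d := d) (L := L) B k W) t N)
          (WilsonFlow.coeConfig U') e‖
      ≤ (∑ k ∈ Finset.range (N + 1), |t| ^ k * (|β| ^ (k + 1) *
          (4 * ((k : ℝ) + 1) * n * (N0 d n * theta1 d n B ^ k)))) * (∑ a, ‖B.T a‖) * M := by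
  rw [mul_assoc, mul_comm (∑ a, ‖B.T a‖) M, ← mul_assoc]
  exact norm_linkGrad_sub_linkGrad_le B _ _ _ e fun a =>
    abs_linkDeriv_truncFlowAction_smul_gradedSk_sub_le B hn β t N e a U U' hM0 hM

/-! ## 6. Localisation to the plaquette ball and the flow-time window -/

/-- **`K_Z`, LOCAL form** — the hypothesis `hZlip` of THEOREM L (`IsFlowMap.lightCone`) for the
order-`N` truncated Wilson-flow generator with `N e = linkBall (2(N+1)) e`: if
`‖U_{e'} − U'_{e'}‖_F ≤ M` for the links `e'` of the ball only, the same bound holds, because the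
generator at `e` does not see the other links (`GeneratorLocality`). Volume-independent. [ours] -/
theorem norm_linkGrad_truncFlowAction_smul_gradedSk_sub_le_of_linkBall (hn : n ≠ 0) (β t : ℝ) (N : ℕ)
    (e : Edge d L) (U U' : GaugeConfig d L (Matrix.specialUnitaryGroup (Fin n) ℂ)) {M : ℝ}
    (hM0 : 0 ≤ M)
    (hM : ∀ e' ∈ linkBall (2 * (N + 1)) e, ‖WilsonFlow.coeConfig U e' - WilsonFlow.coeConfig U' e'‖ ≤ M) :
    ‖linkGrad B (truncFlowAction (fun k W => β ^ (k + 1) * gradedSk (d := d) (L := L) B k W) t N)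
          (WilsonFlow.coeConfig U) e
      - linkGrad B (truncFlowAction (fun k W => β ^ (k + 1) * gradedSk (d := d) (L := L) B k W) t N)
          (WilsonFlow.coeConfig U') e‖
      ≤ (∑ k ∈ Finset.range (N + 1), |t| ^ k * (|β| ^ (k + 1) *
          (4 * ((k : ℝ) + 1) * n * (N0 d n * theta1 d n B ^ k)))) * (∑ a, ‖B.T a‖) * M := by
  classical
  -- hybrid configuration: `U'` on the ball, `U` outside
  let U'' : GaugeConfig d L (Matrix.specialUnitaryGroup (Fin n) ℂ) :=
    fun e' => if e' ∈ linkBall (2 * (N + 1)) e then U' e' else U e'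
  have hU'U'' : ∀ e' ∈ linkBall (2 * (N + 1)) e, U' e' = U'' e' := by
    intro e' he'
    simp only [U'', he', if_true]
  have hM'' : ∀ e', ‖WilsonFlow.coeConfig U e' - WilsonFlow.coeConfig U'' e'‖ ≤ M := by
    intro e'
    by_cases he' : e' ∈ linkBall (2 * (N + 1)) e
    · have : WilsonFlow.coeConfig U'' e' = WilsonFlow.coeConfig U' e' := by
        simp only [WilsonFlow.coeConfig_apply, U'', he', if_true]
      rw [this]; exact hM e' he'
    · have : WilsonFlow.coeConfig U'' e' = WilsonFlow.coeConfig U e' := by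
        simp only [WilsonFlow.coeConfig_apply, U'', he', if_false]
      rw [this, sub_self, norm_zero]; exact hM0
  rw [linkGrad_truncFlowAction_local B β (contDiff_smul_gradedSk B β) (isLuscherSeries_smul_gradedSk B β)
    t N e hU'U'']
  exact norm_linkGrad_truncFlowAction_smul_gradedSk_sub_le B hn β t N e U U'' hM0 hM''

omit [NeZero L] in
/-- The Lipschitz constant is a polynomial in `|t|` with nonnegative coefficients; on a window
`|t| ≤ T` it may be taken at `T`. [folklore] -/
theorem lipschitzSum_le_of_abs_le {t T : ℝ} (htT : |t| ≤ T) (β : ℝ) (N : ℕ) :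
    (∑ k ∈ Finset.range (N + 1), |t| ^ k * (|β| ^ (k + 1) *
        (4 * ((k : ℝ) + 1) * n * (N0 d n * theta1 d n B ^ k))))
      ≤ ∑ k ∈ Finset.range (N + 1), T ^ k * (|β| ^ (k + 1) *
        (4 * ((k : ℝ) + 1) * n * (N0 d n * theta1 d n B ^ k))) := by
  refine Finset.sum_le_sum fun k _ => mul_le_mul_of_nonneg_right (pow_le_pow_left₀ (abs_nonneg t) htT k) ?_
  have h0 := N0_nonneg d n
  have h1 : (0 : ℝ) ≤ theta1 d n B := zero_le_one.trans (one_le_theta1 d n B)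
  positivity

/-- **`K_Z` on a flow-time window** — exactly the shape of `hZlip` in THEOREM L with a `t`-INDEPENDENT
constant: for `t ∈ [0,T)`, all `U, U'`, every link `e` and every `M ≥ 0` dominating the link differences
on `linkBall (2(N+1)) e`,
`‖∂S̃^{[N]}_{β,t}(ιU)(e) − ∂S̃^{[N]}_{β,t}(ιU')(e)‖_F ≤ K_Z(T) · M`,
`K_Z(T) = (∑_{k≤N} T^k |β|^{k+1} 4(k+1) n N₀ θ₁^k) ∑ₐ ‖T^a‖_F` — no dependence on `L`. [ours] -/
theorem norm_linkGrad_truncFlowAction_smul_gradedSk_sub_le_window (hn : n ≠ 0) (β T : ℝ) (N : ℕ) :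
    ∀ t ∈ Set.Ico (0 : ℝ) T, ∀ (U U' : GaugeConfig d L (Matrix.specialUnitaryGroup (Fin n) ℂ))
      (e : Edge d L) (M : ℝ), 0 ≤ M →
      (∀ e' ∈ linkBall (2 * (N + 1)) e,
          ‖WilsonFlow.coeConfig U e' - WilsonFlow.coeConfig U' e'‖ ≤ M) →
      ‖linkGrad B (truncFlowAction (fun k W => β ^ (k + 1) * gradedSk (d := d) (L := L) B k W) t N)
            (WilsonFlow.coeConfig U) e
        - linkGrad B (truncFlowAction (fun k W => β ^ (k + 1) * gradedSk (d := d) (L := L) B k W) t N)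
            (WilsonFlow.coeConfig U') e‖
        ≤ ((∑ k ∈ Finset.range (N + 1), T ^ k * (|β| ^ (k + 1) *
            (4 * ((k : ℝ) + 1) * n * (N0 d n * theta1 d n B ^ k)))) * ∑ a, ‖B.T a‖) * M := by
  intro t ht U U' e M hM0 hM
  have htT : |t| ≤ T := by rw [abs_of_nonneg ht.1]; exact ht.2.le
  refine (norm_linkGrad_truncFlowAction_smul_gradedSk_sub_le_of_linkBall B hn β t N e U U' hM0 hM).trans ?_
  refine mul_le_mul_of_nonneg_right ?_ hM0
  exact mul_le_mul_of_nonneg_right (lipschitzSum_le_of_abs_le B htT β N)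
    (Finset.sum_nonneg fun a _ => norm_nonneg _)

/-- The same window bound for the generators `Z_t = -∂S̃^{[N]}_{β,t}` themselves (eq. (3.6) of
[Luscher2010Trivializing]): `‖Z_t(ιU)(e) − Z_t(ιU')(e)‖_F ≤ K_Z(T) · M`. [ours] -/
theorem norm_neg_linkGrad_truncFlowAction_smul_gradedSk_sub_le_window (hn : n ≠ 0) (β T : ℝ) (N : ℕ) :
    ∀ t ∈ Set.Ico (0 : ℝ) T, ∀ (U U' : GaugeConfig d L (Matrix.specialUnitaryGroup (Fin n) ℂ))
      (e : Edge d L) (M : ℝ), 0 ≤ M →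
      (∀ e' ∈ linkBall (2 * (N + 1)) e,
          ‖WilsonFlow.coeConfig U e' - WilsonFlow.coeConfig U' e'‖ ≤ M) →
      ‖-linkGrad B (truncFlowAction (fun k W => β ^ (k + 1) * gradedSk (d := d) (L := L) B k W) t N)
            (WilsonFlow.coeConfig U) e
        - -linkGrad B (truncFlowAction (fun k W => β ^ (k + 1) * gradedSk (d := d) (L := L) B k W) t N)
            (WilsonFlow.coeConfig U') e‖
        ≤ ((∑ k ∈ Finset.range (N + 1), T ^ k * (|β| ^ (k + 1) *
            (4 * ((k : ℝ) + 1) * n * (N0 d n * theta1 d n B ^ k)))) * ∑ a, ‖B.T a‖) * M := by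
  intro t ht U U' e M hM0 hM
  rw [neg_sub_neg, norm_sub_rev]
  exact norm_linkGrad_truncFlowAction_smul_gradedSk_sub_le_window B hn β T N t ht U U' e M hM0 hM

end GradedSeries

end Summit.Ventures.LatticeQCDFlow.TrivializingMaps
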